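import Mathlib.Combinatorics.SimpleGraph.Cayley
import Mathlib.Combinatorics.SimpleGraph.Maps
import Mathlib.GroupTheory.Finiteness
import HarnessLib

/-!
# Cayley graphs with few automorphisms: every finitely generated group has a Cayley graph with a DISCRETE automorphism group
# (Leemann–de la Salle 2022, Cor. 1.3)

NAMED FACT (statement only, not proved here).  Source: P.-H. Leemann and M. de la Salle, *Cayley graphs with few automorphisms: the
case of infinite groups*, Annales Henri Lebesgue 5 (2022) 73–92 (arXiv:2010.06020), Corollary 1.3 — "Every finitely generated group admits
a finite degree Cayley graph whose automorphism group is countable" — together with the sentence following it: for the topology of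
pointwise convergence the stabiliser of a vertex is compact, hence finite or uncountable, so the corollary "can be equivalently phrased
as *Every finitely generated group admits a finite degree Cayley graph whose automorphism group is discrete (equivalently has finite
stabilizers)*".  It is a consequence of their Theorem 1.1 (every finitely generated group that is not virtually abelian admits a finite
degree Cayley graph whose automorphism group is the group itself acting by left translations — a graphical regular representation).

Formalisation choices.  "Finite degree Cayley graph of `Γ`" = Mathlib's `SimpleGraph.mulCayley ↑S` for a finite GENERATING set
`S : Finset Γ` (vertices `Γ`; `u ~ v` iff `u ≠ v` and `u g = v` or `v g = u` for some `g ∈ S`, i.e. the simple undirected Cayley graph of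
`S ∪ S⁻¹`; left translations are automorphisms); "finite stabilizers" = the stabiliser of the vertex `1` in the automorphism group
`mulCayley ↑S ≃g mulCayley ↑S` is a finite set (all vertex stabilisers are then finite, being conjugate to it by left translations).
What is NOT here: Theorem 1.1 itself (GRRs off virtually abelian groups), Corollary 1.2 (the list of groups without a GRR), Corollary 1.4
(LG-rigidity) — `-- TODO(general form): Thm. 1.1 gives Aut(Cay(Γ; S)) = Γ for Γ not virtually abelian`.
Used by `Summits/CriticalPhenomena/PercolationContinuityZ3/Theorems/Transplant/AutDiscreteWallCayley.lean` (lane prim-bschramm).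
-/

namespace Literature.Combinatorics.SimpleGraph

/-- **Leemann–de la Salle 2022, Corollary 1.3 (finite-stabiliser phrasing of the sentence following it)**: every finitely generated group
`Γ` admits a finite generating set `S` whose Cayley graph `Cay(Γ; S)` (Mathlib's `SimpleGraph.mulCayley ↑S`) has a discrete automorphism
group, i.e. the stabiliser of the vertex `1` in `Aut(Cay(Γ; S))` is finite.  Unproved here; users take it as a hypothesis
`(h : LeemannDeLaSalle2022_discreteCayleyGraph)`.
-- TODO(general form): Thm. 1.1 — for `Γ` not virtually abelian, `S` can be chosen with `Aut(Cay(Γ; S)) = Γ` (left translations only).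
[cite: LeemannDelasalle2022, Cor. 1.3] -/
def LeemannDeLaSalle2022_discreteCayleyGraph : Prop :=
  ∀ (Γ : Type) [Group Γ], Group.FG Γ →
    ∃ S : Finset Γ, Subgroup.closure (↑S : Set Γ) = ⊤ ∧
      {α : _root_.SimpleGraph.mulCayley (↑S : Set Γ) ≃g _root_.SimpleGraph.mulCayley (↑S : Set Γ) | α 1 = 1}.Finite

end Literature.Combinatorics.SimpleGraph
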